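import Mathlib
import HarnessLib

/-!
# Products of hop factors: the neutral (scale) direction converges when the per-hop corrections are summable
  (helper for stmt-NavierStokesRegularity-23908 `MirrorSolitaryWave` ((WG): one limiting amplitude `κ`) and
  stmt-…-23909 `GradedAdiabaticWake` (HOP-INVARIANT-50 §4 (K5): the anchor-jitter product `Π(1 + C'δ_n) < ∞`);
  route TaoLadderRungTwoFlat; cell harvest/h2-tao-ladder, p1 g21)

Along the hop iteration the pulse-family parameter is re-matched every hop (`hop_renormalisation`: `κ_{N+1} = κ_N(1+c_N)`
with `|c_N| ≤ C·B_N`, the neutral coefficient), and `B_N` decays geometrically by the two-zone loop (`…TwoZoneLoop`).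
This file is the elementary bookkeeping that turns summable corrections into a convergent, non-degenerate product:

* `abs_prod_le_prod_abs`, `abs_prod_one_add_sub_one_le` — `|∏(1+cₙ) − 1| ≤ ∏(1+|cₙ|) − 1 ≤ exp(Σ|cₙ|) − 1`;
* `hopSeq_eq_prod` — `κ_N = κ_0·∏_{n<N}(1+c_n)` for `κ_{N+1} = κ_N(1+c_N)`;
* `abs_hopSeq_le` — `|κ_N| ≤ |κ_0|·e^{S}` when all partial sums `Σ_{n<N}|c_n| ≤ S`;
* `hopSeq_lower` — `κ_N ≥ κ_0·e^{−2S} > 0` when moreover `κ_0 > 0` and `|c_n| ≤ 1/2` (non-degenerate limit);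
* `abs_hopSeq_succ_sub_le` — `|κ_{N+1} − κ_N| ≤ |κ_0|e^{S}·|c_N|`;
* `hopSeq_tendsto` — `Summable |c|` ⇒ `κ_N → κ_∞` with the tail bound `|κ_N − κ_∞| ≤ |κ_0|e^{S}·Σ_{n≥N}|c_n|`.

HONEST FRAMING: elementary real analysis; nothing specific to any lattice is asserted; nothing about the Navier–Stokes
equations.
-/

noncomputable section

-- the sub-problem namespace repeats the summit name by design (D-0017)
set_option linter.dupNamespace false

namespace Summit.NavierStokesRegularity.NavierStokesRegularity.Theorems

open Filter Topology

namespace HopProduct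

/-- `|∏_{n∈s}(1 + cₙ)| ≤ ∏_{n∈s}(1 + |cₙ|)`. [folklore] -/
theorem abs_prod_le_prod_abs (s : Finset ℕ) (c : ℕ → ℝ) :
    |∏ n ∈ s, (1 + c n)| ≤ ∏ n ∈ s, (1 + |c n|) := by
  rw [Finset.abs_prod]
  exact Finset.prod_le_prod (fun n _ => abs_nonneg _) fun n _ =>
    (abs_add_le _ _).trans (by rw [abs_one])

/-- `|∏_{n∈s}(1 + cₙ) − 1| ≤ ∏_{n∈s}(1 + |cₙ|) − 1`. [folklore] -/
theorem abs_prod_one_add_sub_one_le (s : Finset ℕ) (c : ℕ → ℝ) :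
    |∏ n ∈ s, (1 + c n) - 1| ≤ ∏ n ∈ s, (1 + |c n|) - 1 := by
  induction s using Finset.induction_on with
  | empty => simp
  | insert a s ha ih =>
    rw [Finset.prod_insert ha, Finset.prod_insert ha]
    set P := ∏ n ∈ s, (1 + c n) with hP
    set Q := ∏ n ∈ s, (1 + |c n|) with hQ
    have hPQ : |P| ≤ Q := abs_prod_le_prod_abs s c
    have e : (1 + c a) * P - 1 = (P - 1) + c a * P := by ring
    rw [e]
    calc |(P - 1) + c a * P| ≤ |P - 1| + |c a * P| := abs_add_le _ _
      _ = |P - 1| + |c a| * |P| := by rw [abs_mul]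
      _ ≤ (Q - 1) + |c a| * Q := add_le_add ih (mul_le_mul_of_nonneg_left hPQ (abs_nonneg _))
      _ = (1 + |c a|) * Q - 1 := by ring

/-- `∏_{n∈s}(1 + |cₙ|) ≤ exp(Σ_{n∈s}|cₙ|)`. [folklore] -/
theorem prod_one_add_abs_le_exp (s : Finset ℕ) (c : ℕ → ℝ) :
    ∏ n ∈ s, (1 + |c n|) ≤ Real.exp (∑ n ∈ s, |c n|) := by
  rw [Real.exp_sum]
  exact Finset.prod_le_prod (fun n _ => by positivity) fun n _ => by
    have := Real.add_one_le_exp (|c n|); linarith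

/-! ### The hop sequence `κ_{N+1} = κ_N (1 + c_N)` -/

/-- The hop sequence is the partial product. [folklore] -/
theorem hopSeq_eq_prod {κ c : ℕ → ℝ} (hκ : ∀ N, κ (N + 1) = κ N * (1 + c N)) (N : ℕ) :
    κ N = κ 0 * ∏ n ∈ Finset.range N, (1 + c n) := by
  induction N with
  | zero => simp
  | succ N ih => rw [hκ N, ih, Finset.prod_range_succ]; ring

/-- **Upper bound**: `|κ_N| ≤ |κ_0|·e^{S}` when every partial sum `Σ_{n<N}|c_n| ≤ S`. [folklore] -/
theorem abs_hopSeq_le {κ c : ℕ → ℝ} {S : ℝ} (hκ : ∀ N, κ (N + 1) = κ N * (1 + c N))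
    (hS : ∀ N, ∑ n ∈ Finset.range N, |c n| ≤ S) (N : ℕ) : |κ N| ≤ |κ 0| * Real.exp S := by
  rw [hopSeq_eq_prod hκ N, abs_mul]
  refine mul_le_mul_of_nonneg_left ?_ (abs_nonneg _)
  exact (abs_prod_le_prod_abs _ c).trans ((prod_one_add_abs_le_exp _ c).trans (Real.exp_le_exp.mpr (hS N)))

/-- **Lower bound (non-degeneracy)**: if `κ_0 > 0`, `|c_n| ≤ 1/2` and all partial sums `Σ_{n<N}|c_n| ≤ S`, then
`κ_N ≥ κ_0·e^{−2S} > 0` (from `1 + c ≥ 1 − |c| ≥ e^{−2|c|}` on `|c| ≤ 1/2`). [folklore] -/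
theorem hopSeq_lower {κ c : ℕ → ℝ} {S : ℝ} (hκ : ∀ N, κ (N + 1) = κ N * (1 + c N)) (h0 : 0 < κ 0)
    (hc : ∀ n, |c n| ≤ 1 / 2) (hS : ∀ N, ∑ n ∈ Finset.range N, |c n| ≤ S) (N : ℕ) :
    κ 0 * Real.exp (-2 * S) ≤ κ N := by
  -- per factor: e^{-2|c|} ≤ 1 − |c| ≤ 1 + c
  have hfac : ∀ n, Real.exp (-2 * |c n|) ≤ 1 + c n := by
    intro n
    have hx := hc n
    have hx0 : 0 ≤ |c n| := abs_nonneg _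
    -- convexity bound: e^{-2x} ≤ 1 - x on [0, 1/2], via e^{-2x}·(1 + 2x + 2x²)… use: e^{2x} ≥ 1 + 2x ≥ 1/(1-x) fails;
    -- instead: (1 - x)·e^{2x} ≥ (1 - x)(1 + 2x) = 1 + x - 2x² ≥ 1 for x ∈ [0, 1/2].
    have h1 : 1 + 2 * |c n| ≤ Real.exp (2 * |c n|) := by
      have := Real.add_one_le_exp (2 * |c n|); linarith
    have h2 : 1 ≤ (1 - |c n|) * Real.exp (2 * |c n|) := by
      have h3 : (1 - |c n|) * (1 + 2 * |c n|) ≤ (1 - |c n|) * Real.exp (2 * |c n|) :=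
        mul_le_mul_of_nonneg_left h1 (by linarith)
      nlinarith
    have h4 : Real.exp (-2 * |c n|) * Real.exp (2 * |c n|) = 1 := by
      rw [← Real.exp_add]; simp
    have h5 : Real.exp (-2 * |c n|) ≤ 1 - |c n| := by
      by_contra hneg
      push Not at hneg
      have hpos : 0 < Real.exp (2 * |c n|) := Real.exp_pos _
      have : (1 - |c n|) * Real.exp (2 * |c n|) < Real.exp (-2 * |c n|) * Real.exp (2 * |c n|) :=
        mul_lt_mul_of_pos_right hneg hpos
      linarith
    have h6 : 1 - |c n| ≤ 1 + c n := by linarith [neg_abs_le (c n)]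
    exact h5.trans h6
  -- product
  rw [hopSeq_eq_prod hκ N]
  refine mul_le_mul_of_nonneg_left ?_ h0.le
  have hprod : Real.exp (-2 * ∑ n ∈ Finset.range N, |c n|) ≤ ∏ n ∈ Finset.range N, (1 + c n) := by
    rw [Finset.mul_sum, Real.exp_sum]
    exact Finset.prod_le_prod (fun n _ => (Real.exp_pos _).le) fun n _ => hfac n
  refine le_trans ?_ hprod
  exact Real.exp_le_exp.mpr (by nlinarith [hS N])

/-- **Increments**: `|κ_{N+1} − κ_N| ≤ |κ_0|·e^{S}·|c_N|`. [folklore] -/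
theorem abs_hopSeq_succ_sub_le {κ c : ℕ → ℝ} {S : ℝ} (hκ : ∀ N, κ (N + 1) = κ N * (1 + c N))
    (hS : ∀ N, ∑ n ∈ Finset.range N, |c n| ≤ S) (N : ℕ) :
    |κ (N + 1) - κ N| ≤ |κ 0| * Real.exp S * |c N| := by
  have e : κ (N + 1) - κ N = κ N * c N := by rw [hκ N]; ring
  rw [e, abs_mul]
  exact mul_le_mul_of_nonneg_right (abs_hopSeq_le hκ hS N) (abs_nonneg _)

/-- **CONVERGENCE OF THE NEUTRAL DIRECTION.** If the corrections are absolutely summable then the hop sequence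
converges, with the tail bound `|κ_N − κ_∞| ≤ |κ_0|·e^{S}·Σ_{n≥0}|c_{N+n}|` (`S = Σ|c_n|`). With `|c_N| ≤ C·B_N` and `B_N`
geometric (two-zone loop) this is the single limiting amplitude `κ` of (WG) / the finite anchor-jitter product of (K5).
[folklore] -/
theorem hopSeq_tendsto {κ c : ℕ → ℝ} (hκ : ∀ N, κ (N + 1) = κ N * (1 + c N)) (hc : Summable fun n => |c n|) :
    ∃ κinf : ℝ, Tendsto κ atTop (𝓝 κinf) ∧
      ∀ N, |κ N - κinf| ≤ |κ 0| * Real.exp (∑' n, |c n|) * ∑' n, |c (N + n)| := by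
  set S : ℝ := ∑' n, |c n| with hSdef
  have hS : ∀ N, ∑ n ∈ Finset.range N, |c n| ≤ S := fun N =>
    hc.sum_le_tsum (Finset.range N) (fun n _ => abs_nonneg _)
  set d : ℕ → ℝ := fun n => |κ 0| * Real.exp S * |c n| with hd
  have hdist : ∀ n, dist (κ n) (κ n.succ) ≤ d n := fun n => by
    rw [Real.dist_eq, abs_sub_comm]
    exact abs_hopSeq_succ_sub_le hκ hS n
  have hdsum : Summable d := hc.mul_left _
  have hcauchy : CauchySeq κ := cauchySeq_of_dist_le_of_summable d hdist hdsum
  obtain ⟨κinf, hlim⟩ := cauchySeq_tendsto_of_complete hcauchy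
  refine ⟨κinf, hlim, fun N => ?_⟩
  have h := dist_le_tsum_of_dist_le_of_tendsto d hdist hdsum hlim N
  rw [Real.dist_eq] at h
  refine h.trans (le_of_eq ?_)
  rw [hd]
  simp only
  rw [tsum_mul_left]

end HopProduct

end Summit.NavierStokesRegularity.NavierStokesRegularity.Theorems

end
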